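import Summits.CriticalPhenomena.PercolationContinuityZ3.Theorems.PercNearOneGluingNoHeavyLowerTailSahiRecursionCert
import Summits.CriticalPhenomena.PercolationContinuityZ3.Theorems.PercNearOneGluingNoHeavyLowerTailSahiC3CubeColourCheck

/-!
# Sahi's `C_n` on the cube `{0,1}^m` by `n`-COLOURED ANTICHAINS MODULO THE SYMMETRIES OF THE CUBE, I: the checker — canonical
# antichains under the coordinate permutations, canonical colourings under the stabiliser and relabelling — and its completeness

Support file (cell `prim-sahi`, seat `prim-sahi-typer` gen 29; `--supports stmt-CriticalPhenomena-4575`).  Computable definitions and pure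
proofs (standard axioms); nothing is evaluated here — the evaluations (orders `5, 6, …` at `m = 5`) live in separate COMPUTATIONAL files, the
soundness (from a passing check to `SahiPositive (bernoulliWeight p) n` for every `p`) in parts II–III (…`SahiSymCubeOrbit`, …`SahiSymCubeSound`).

By the value-level saturation reduction with surjective colourings (`SahiAbsorbed.sahiPositive_of_surjColouring`: given `C_k(μ)` for `k < n`),
Sahi's `C_n(μ_p)` on `2^{Fin m}` is decided on the families `U_i = {S | ∀ T ∈ N, c T = i → ¬ S ⊆ T}` co-generated by the antichains `N` of
the cube with a colouring `c` using all `n` colours.  `E_n(μ_p; U_0, …, U_{n-1})` is invariant under (a) relabelling the colours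
(`sahiE_comp_perm`) and (b) the coordinate permutations `σ ∈ S_m` acting on the cube, with `p ↦ p ∘ σ⁻¹`; since the digit test
`NCopyCert.checkFamW` certifies a family for EVERY `p` at once, it suffices to test ONE coloured antichain per orbit of `S_m × S_n`.  The checker
of this file does exactly that:

* `canonE m` — the antichains `E ⊆ [0, 2^m)` (points as bitmasks) that are lexicographically minimal (`keyE` = increasing list) among their
  images under all coordinate permutations (`permsL`, `actL`, `imgL`, `isCanonE`), collected by an include/exclude recursion `goAL`;
* for each of them, `colourPhase`: the restricted-growth colour lists `cl` with `n` colours (`goCol`), skipping those not using all colours and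
  those some stabiliser element pulls back (`posPerms`) to a smaller restricted-growth list (`rgs`, `isCanonC`); the survivors are TESTED
  (`test` on the members `memN m (maskC …)`; the tree's test is `testN` = `NCopyCert.checkFamW` with its base conditions);
* `symCheck m n σb` — all of it; `symCheckRange` / `symCheckFrom` — consecutive ranges of canonical antichains (how computational chunks are cut),
  `symCheckFrom_of_range`, `symCheck_of_from`;
* completeness: **`canonE_complete`** (every canonical antichain is listed) and **`colourPhase_complete`** (every restricted-growth list with all
  `n` colours that is canonical is tested).
At `m = 5`: `210` canonical antichains (of `7 581`); tested colourings at orders `3, …, 8`: `5 625, 7 107, 4 429, 1 532, 328, 49` (against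
`41 474, 104 696, 109 380, 53 220, 12 898, 1 579` axis representatives × restricted-growth colourings of the cell's external census). [this work]
-/

namespace Summit.CriticalPhenomena.PercolationContinuityZ3.Theorems.SahiSymCube

open Finset OneCutCert CovTransferCert SahiC3Cube NCopyCert

/-! ## Coordinate permutations acting on points -/

/-- All permutations of the coordinates `0, …, m-1`, as lists (`p[i]` = image of coordinate `i`). [this work] -/
def permsL (m : ℕ) : List (List ℕ) := (List.range m).permutations

/-- The action of a coordinate map (list form) on a point of the cube: bit `j < m` of the image is set iff some coordinate `i < m` with
`p[i] = j` is present in `x`. [this work] -/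
def actL (m : ℕ) (p : List ℕ) (x : ℕ) : ℕ :=
  ofBits (fun j => decide (∃ i < m, p.getD i 0 = j ∧ x.testBit i = true)) m

/-- The action of a permutation of `Fin m` on points (through its list). [this work] -/
def actP (m : ℕ) (σ : Equiv.Perm (Fin m)) (x : ℕ) : ℕ := actL m (List.ofFn fun i : Fin m => ((σ i : Fin m) : ℕ)) x

/-- Image of a point set under a coordinate map (list form). [this work] -/
def imgL (m : ℕ) (p : List ℕ) (E : Finset ℕ) : Finset ℕ := E.image (actL m p)

/-- Image of a point set under a permutation. [this work] -/
def imgE (m : ℕ) (σ : Equiv.Perm (Fin m)) (E : Finset ℕ) : Finset ℕ := E.image (actP m σ)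

/-- The KEY of a point set: its increasing list. [this work] -/
def keyE (E : Finset ℕ) : List ℕ := E.sort (· ≤ ·)

/-- A point set is CANONICAL if no coordinate permutation gives a lexicographically smaller key. [this work] -/
def isCanonE (m : ℕ) (E : Finset ℕ) : Bool :=
  (permsL m).all fun p => !decide (keyE (imgL m p E) < keyE E)

/-- The stabiliser of a point set (list permutations fixing it), as the induced PULL-BACK MAPS OF POSITIONS in its key:
`pp[k]` = position of the image of the `k`-th point. [this work] -/
def posPerms (m : ℕ) (E : Finset ℕ) : List (List ℕ) :=
  ((permsL m).filter fun p => imgL m p E = E).map fun p => (keyE E).map fun x => (keyE E).idxOf (actL m p x)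

/-! ## Restricted-growth relabelling of colour lists -/

/-- Restricted-growth relabelling, `seen` = the values already labelled, in order of first occurrence. [this work] -/
def rgsAux : List ℕ → List ℕ → List ℕ
  | _, [] => []
  | seen, a :: l => if a ∈ seen then seen.idxOf a :: rgsAux seen l else seen.length :: rgsAux (seen ++ [a]) l

/-- The restricted-growth relabelling of a list of colours (first occurrences get `0, 1, 2, …` in order). [this work] -/
def rgs (l : List ℕ) : List ℕ := rgsAux [] l

/-- A colour list `cl` (aligned with the key of the point set) is CANONICAL if no stabiliser element (given by its position map) pulls it
back to a lexicographically smaller restricted-growth list. [this work] -/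
def isCanonC (pps : List (List ℕ)) (cl : List ℕ) : Bool :=
  pps.all fun pp => !decide (rgs (pp.map fun k => cl.getD k 0) < cl)

/-! ## Members and the colour phase -/

/-- The down-mask of colour `i`: the points below some point `P[j]` of colour `cl[j] = i`. [this work] -/
def maskC (m : ℕ) (P cl : List ℕ) (i : ℕ) : ℕ :=
  ofBits (fun y => decide (∃ j < P.length, cl.getD j 0 = i ∧ y &&& P.getD j 0 = y)) (2 ^ m)

/-- The colour phase on a point set with key `P` and position maps `pps`: restricted-growth colour lists with `n` colours (`k` points left,
`nc` colours used, `crev` the colours so far, reversed); at a leaf, lists not using all `n` colours or not canonical are skipped, the others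
are TESTED on their members `memN m (maskC …)`. [this work] -/
def goCol (m n : ℕ) (test : (Fin n → ℕ) → Bool) (P : List ℕ) (pps : List (List ℕ)) : ℕ → ℕ → List ℕ → Bool
  | 0, nc, crev =>
      decide (nc < n) ||
        (!isCanonC pps crev.reverse || test fun i => memN m (maskC m P crev.reverse i))
  | k + 1, nc, crev => (List.range (min (nc + 1) n)).all fun i => goCol m n test P pps k (max nc (i + 1)) (i :: crev)

/-- The colour phase of one point set. [this work] -/
def colourPhase (m n : ℕ) (test : (Fin n → ℕ) → Bool) (E : Finset ℕ) : Bool :=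
  goCol m n test (keyE E) (posPerms m E) E.card 0 []

/-! ## The antichain phase -/

/-- Include/exclude recursion over the points `q, q+1, …` (`fuel` left) with exclusion mask `forb` (the comparability cones of the chosen
points `E`), collecting the CANONICAL antichains in front of `acc`. [this work] -/
def goAL (m : ℕ) : ℕ → ℕ → ℕ → Finset ℕ → List (Finset ℕ) → List (Finset ℕ)
  | 0, _, _, E, acc => if isCanonE m E then E :: acc else acc
  | fuel + 1, q, forb, E, acc =>
      if forb.testBit q then goAL m fuel (q + 1) forb E acc
      else goAL m fuel (q + 1) (forb ||| coneN m q) (insert q E) (goAL m fuel (q + 1) forb E acc)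

/-- The canonical antichains of the `m`-cube (one per orbit of the coordinate permutations; `210` at `m = 5`). [this work] -/
def canonE (m : ℕ) : List (Finset ℕ) := goAL m (2 ^ m) 0 0 ∅ []

/-! ## The digit test and the check -/

/-- The order-`n` digit test of a family of member bitmasks of the `m`-cube in base `2^σb` (positions in base `n+1`), WITH its base
conditions: `NCopyCert.checkFamW`, Kronecker numbers computed on the fly. [this work] -/
def testN (m n σb : ℕ) (a : Fin n → ℕ) : Bool :=
  decide (0 < σb) && decide (coefBound m n < 2 ^ (σb - 1)) &&
    checkFamW (fun T => (krTB σb (n + 1) m T : ℤ)) (krTB σb (n + 1) m (fullN m)) (maskN σb ((n + 1) ^ m)) (maskN σb ((n + 1) ^ m)) n a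

/-- **The symmetry-reduced coloured-antichain check of order `n` on the `m`-cube** with leaf test `test`. [this work] -/
def symCheckT (m n : ℕ) (test : (Fin n → ℕ) → Bool) : Bool := (canonE m).all (colourPhase m n test)

/-- The check from the canonical antichain number `lo` on. [this work] -/
def symCheckFrom (m n : ℕ) (test : (Fin n → ℕ) → Bool) (lo : ℕ) : Bool := ((canonE m).drop lo).all (colourPhase m n test)

/-- A RANGE of the check: the canonical antichains number `lo, …, lo + len - 1`. [this work] -/
def symCheckRange (m n : ℕ) (test : (Fin n → ℕ) → Bool) (lo len : ℕ) : Bool :=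
  (((canonE m).drop lo).take len).all (colourPhase m n test)

/-- **The check of order `n` on the `m`-cube in base `2^σb`** (leaf test `testN`). [this work] -/
def symCheck (m n σb : ℕ) : Bool := symCheckT m n (testN m n σb)

/-! ## Cutting the check into ranges -/

/-- The whole check is the check from `0`. [this work] -/
theorem symCheck_of_from {m n : ℕ} {test : (Fin n → ℕ) → Bool} (h : symCheckFrom m n test 0 = true) : symCheckT m n test = true := by
  unfold symCheckFrom at h
  rwa [List.drop_zero] at h

/-- A range followed by the rest is the rest from the start of the range. [this work] -/
theorem symCheckFrom_of_range {m n : ℕ} {test : (Fin n → ℕ) → Bool} {lo len : ℕ} (h₁ : symCheckRange m n test lo len = true)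
    (h₂ : symCheckFrom m n test (lo + len) = true) : symCheckFrom m n test lo = true := by
  unfold symCheckRange at h₁
  unfold symCheckFrom at h₂ ⊢
  rw [← List.take_append_drop len ((canonE m).drop lo), List.all_append, Bool.and_eq_true]
  refine ⟨h₁, ?_⟩
  simpa only [List.drop_drop, Nat.add_comm] using h₂

/-- Past the end there is nothing to check. [this work] -/
theorem symCheckFrom_of_length_le {m n : ℕ} (test : (Fin n → ℕ) → Bool) {lo : ℕ} (h : (canonE m).length ≤ lo) :
    symCheckFrom m n test lo = true := by
  unfold symCheckFrom
  rw [List.drop_eq_nil_of_le h, List.all_nil]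

/-! ## Completeness of the antichain phase -/

/-- The recursion only adds to its accumulator. [this work] -/
theorem mem_goAL_of_mem (m : ℕ) : ∀ (fuel q forb : ℕ) (E : Finset ℕ) (acc : List (Finset ℕ)) {D : Finset ℕ},
    D ∈ acc → D ∈ goAL m fuel q forb E acc := by
  intro fuel
  induction fuel with
  | zero =>
    intro q forb E acc D hD
    unfold goAL
    split_ifs
    · exact List.mem_cons_of_mem _ hD
    · exact hD
  | succ fuel ih =>
    intro q forb E acc D hD
    unfold goAL
    split_ifs
    · exact ih _ _ _ _ hD
    · exact ih _ _ _ _ (ih _ _ _ _ hD)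

/-- **Completeness of `goAL`**: from the state `(q, forb, E)`, every canonical `E ∪ D` with `D ⊆ [q, 2^m)` avoiding `forb` and pairwise
incomparable is collected. [this work] -/
theorem goAL_complete (m : ℕ) : ∀ (fuel q forb : ℕ) (E : Finset ℕ) (acc : List (Finset ℕ)), q + fuel = 2 ^ m →
    ∀ D : Finset ℕ, (∀ x ∈ D, q ≤ x ∧ x < 2 ^ m) → (∀ x ∈ D, forb.testBit x = false) →
      (∀ x ∈ D, ∀ y ∈ D, x ≠ y → x &&& y ≠ x) → isCanonE m (E ∪ D) = true → E ∪ D ∈ goAL m fuel q forb E acc := by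
  intro fuel
  induction fuel with
  | zero =>
    intro q forb E acc hq D hD _ _ hcan
    have hD0 : D = ∅ := by
      refine eq_empty_of_forall_notMem fun x hx => ?_
      have := hD x hx
      omega
    subst hD0
    rw [union_empty] at hcan ⊢
    unfold goAL
    rw [if_pos hcan]
    exact List.mem_cons_self
  | succ fuel ih =>
    intro q forb E acc hq D hD hforb hanti hcan
    have hq' : q + 1 + fuel = 2 ^ m := by omega
    unfold goAL
    by_cases hqD : q ∈ D
    · have hfq : forb.testBit q = false := hforb q hqD
      rw [if_neg (by rw [hfq]; exact Bool.false_ne_true)]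
      have hE' : ∀ x ∈ D.erase q, q + 1 ≤ x ∧ x < 2 ^ m := by
        intro x hx
        obtain ⟨hxq, hxD⟩ := mem_erase.1 hx
        have := hD x hxD
        omega
      have hforb' : ∀ x ∈ D.erase q, (forb ||| coneN m q).testBit x = false := by
        intro x hx
        obtain ⟨hxq, hxD⟩ := mem_erase.1 hx
        rw [Nat.testBit_lor, hforb x hxD, Bool.false_or, testBit_coneN]
        have h1 : x &&& q ≠ x := hanti x hxD q hqD hxq
        have h2 : q &&& x ≠ q := hanti q hqD x hxD (Ne.symm hxq)
        simp [h1, h2]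
      have hanti' : ∀ x ∈ D.erase q, ∀ y ∈ D.erase q, x ≠ y → x &&& y ≠ x :=
        fun x hx y hy hxy => hanti x (mem_of_mem_erase hx) y (mem_of_mem_erase hy) hxy
      have hEq : insert q E ∪ D.erase q = E ∪ D := by
        rw [insert_union, ← union_insert, insert_erase hqD]
      have := ih (q + 1) (forb ||| coneN m q) (insert q E) (goAL m fuel (q + 1) forb E acc) hq' (D.erase q) hE' hforb' hanti'
        (by rw [hEq]; exact hcan)
      rwa [hEq] at this
    · have hD' : ∀ x ∈ D, q + 1 ≤ x ∧ x < 2 ^ m := by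
        intro x hx
        have := hD x hx
        have hxq : x ≠ q := fun h => hqD (h ▸ hx)
        omega
      have hmem := ih (q + 1) forb E acc hq' D hD' hforb hanti hcan
      split_ifs
      · exact hmem
      · exact mem_goAL_of_mem m _ _ _ _ _ hmem

/-- **Every canonical antichain of the `m`-cube is listed in `canonE m`.** [this work] -/
theorem canonE_complete {m : ℕ} (D : Finset ℕ) (hD : ∀ x ∈ D, x < 2 ^ m) (hanti : ∀ x ∈ D, ∀ y ∈ D, x ≠ y → x &&& y ≠ x)
    (hcan : isCanonE m D = true) : D ∈ canonE m := by
  have h := goAL_complete m (2 ^ m) 0 0 ∅ [] (by simp) D (fun x hx => ⟨Nat.zero_le _, hD x hx⟩) (fun x _ => Nat.zero_testBit x)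
    hanti (by rwa [empty_union])
  rwa [empty_union] at h

/-! ## Completeness of the colour phase -/

/-- The number of colours used after a restricted-growth list, starting from `nc`. [this work] -/
def ncFin : ℕ → List ℕ → ℕ
  | nc, [] => nc
  | nc, a :: l => ncFin (max nc (a + 1)) l

/-- The lists generated by `goCol` from `nc` colours used: each entry is at most the number of colours used so far and `< n`. [this work] -/
def rgOK (n : ℕ) : ℕ → List ℕ → Bool
  | _, [] => true
  | nc, a :: l => decide (a ≤ nc) && decide (a < n) && rgOK n (max nc (a + 1)) l

/-- **Completeness of `goCol`**: every generated extension of the current colour list reaches its leaf. [this work] -/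
theorem goCol_complete {m n : ℕ} (test : (Fin n → ℕ) → Bool) (P : List ℕ) (pps : List (List ℕ)) :
    ∀ (k nc : ℕ) (crev : List ℕ), goCol m n test P pps k nc crev = true → ∀ l : List ℕ, l.length = k → rgOK n nc l = true →
      (decide (ncFin nc l < n) ||
        (!isCanonC pps (crev.reverse ++ l) || test fun i => memN m (maskC m P (crev.reverse ++ l) i))) = true := by
  intro k
  induction k with
  | zero =>
    intro nc crev h l hl _
    rw [List.length_eq_zero_iff] at hl
    subst hl
    unfold goCol at h
    rw [List.append_nil]
    exact h
  | succ k ih =>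
    intro nc crev h l hl hrg
    obtain ⟨a, l', rfl⟩ : ∃ a l', l = a :: l' := by
      cases l with
      | nil => simp at hl
      | cons a l' => exact ⟨a, l', rfl⟩
    unfold rgOK at hrg
    simp only [Bool.and_eq_true, decide_eq_true_eq] at hrg
    obtain ⟨⟨ha, han⟩, hrg'⟩ := hrg
    unfold goCol at h
    rw [List.all_eq_true] at h
    have hmem : a ∈ List.range (min (nc + 1) n) := by
      rw [List.mem_range]; omega
    have h' := ih (max nc (a + 1)) (a :: crev) (h a hmem) l' (by simpa using hl) hrg'
    rw [List.reverse_cons, List.append_assoc, List.singleton_append] at h'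
    exact h'

/-- **Completeness of the colour phase**: a restricted-growth colour list of the right length using all `n` colours that is canonical is
tested. [this work] -/
theorem colourPhase_complete {m n : ℕ} {test : (Fin n → ℕ) → Bool} {E : Finset ℕ} (h : colourPhase m n test E = true)
    (cl : List ℕ) (hlen : cl.length = E.card) (hrg : rgOK n 0 cl = true) (hnc : ncFin 0 cl = n) (hcan : isCanonC (posPerms m E) cl = true) :
    test (fun i => memN m (maskC m (keyE E) cl i)) = true := by
  have h' := goCol_complete test (keyE E) (posPerms m E) E.card 0 [] h cl hlen hrg
  rw [List.reverse_nil, List.nil_append, hnc, hcan] at h'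
  simpa using h'

end Summit.CriticalPhenomena.PercolationContinuityZ3.Theorems.SahiSymCube
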